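import Literature.NumberTheory.Sieve.QuadraticRootsPrimeModuliDFIReduction
import Literature.NumberTheory.Sieve.VaughanMeanValueDecomposition
import HarnessLib

/-!
# Duke–Friedlander–Iwaniec 1995, §7 (ii): "(34) follows from Proposition 1" (PROVED)

Topic `Literature/NumberTheory/Sieve`.  For `f = aX² + 2bX + c ∈ ℤ[X]` with `ac − b² > 0`, `h ≥ 1`
and `0 < ε ≤ 1/12`, DFI's Proposition 1 (the named fact
`Literature.NumberTheory.Sieve.dukeFriedlanderIwaniec1995_proposition1`:
`L_d(M) = ∑_{M<m≤2M} ρ_h(dm) ≪ (h,d)^{1/20} (d/M)^{1/20} M^{1+ε'}` for `d ≪ M`, `h ≪ dM`) implies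
hypothesis (34) of Theorem 5 for `c_n = ρ_h(n)` at level `D = x^{1/2−ε}`:
`R(D) = ∑_{d<D} λ_d ∑_{m ≤ x/d} ρ_h(dm) ≪ x (log x)^{−2}` uniformly in `|λ_d| ≤ 1`
(`DFI1995.hyp34_of_proposition1 : … → DFI1995.Hyp34 (quad a b c) h ε`) — the first of the two
deductions of §7 of W. Duke, J. B. Friedlander, H. Iwaniec, Ann. of Math. 141 (1995), p. 438,
which the paper leaves to the reader.

## The argument

For each `d < D` decompose `S_d(X) = ∑_{m ≤ X} ρ_h(dm)`, `X = ⌊x⌋/d`, dyadically from the top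
(`DFI1995.partialSum_eq_dyadic`): `S_d(X) = S_d(X/2^J) + ∑_{j<J} L_d(X/2^{j+1})` with `2^J ≤ X/d`
maximal, so that every block has `M = X/2^{j+1} ≥ d` (Proposition 1 applies with `ε' = ε/20`,
`(h,d) ≤ h`, `h ≤ h·dM`: `DFI1995.exists_norm_linearForm_le`) and the leftover has `X/2^J < 2d`
(trivial bound from `|ρ_h(n)| ≤ C_f τ(n)`, `τ(dm) ≤ τ(d)τ(m)`, `∑_{m ≤ 2d} τ(m) ≤ 2d(1 + log 2d)`:
`DFI1995.norm_partialSum_le`).  With `J ≤ log₂ x` blocks, each `≤ K₁ d^{1/20} (x/d)^{19/20+ε'}`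
(`DFI1995.norm_partialSum_floor_div_le`) and `d^{1/20}(x/d)^{19/20+ε'} ≤ x^{19/20+ε'} D^{1/10}/d`
for `d ≤ D` (`DFI1995.rpow_mul_div_rpow_le`), summing over `d < D` (`∑_{d ≤ x} 1/d ≤ 1 + log x`,
`∑_{d ≤ D} τ(d) ≤ D(1 + log D)`) gives
`|R(D)| ≤ 2C_f D²(1 + log x)² + 2K₁ x^{19/20+ε'} D^{1/10}(1 + log x)² ≤ (2C_f + 2K₁) x^{1−ε/20}(1 + log x)²`
(`D² = x^{1−2ε}`, `x^{19/20+ε/20} D^{1/10} = x^{1−ε/20}`), which is `≤ A x (log x)^{−2}` as soon as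
`4(log x)^4 ≤ x^{ε/20}`.  Everything here is proved; divisor/harmonic sums from
`VaughanMeanValueDecomposition.lean` (`Vaughan.sum_card_divisors_le`, `Vaughan.card_divisors_mul_le`,
`Vaughan.sum_Ioc_inv_le`).

## References

* W. Duke, J. B. Friedlander, H. Iwaniec, Ann. of Math. (2) 141 (1995), 423–441: Proposition 1
  (p. 425, (9)), (32) and (34) (pp. 436–437), §7 (p. 438). [cite: DukeFriedlanderIwaniec1995, §7]
-/

namespace Literature.NumberTheory.Sieve

open scoped BigOperators Polynomial
open Filter Asymptotics Finset Polynomial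

namespace DFI1995

/-- The trivial bound `|S_d(t)| ≤ C τ(d) ∑_{m ≤ T} τ(m)` from `|ρ_h(n)| ≤ C τ(n)` and
`τ(dm) ≤ τ(d) τ(m)`, for `⌊t⌋₊ ≤ T`. [folklore] -/
theorem norm_partialSum_le {f : ℤ[X]} {h : ℤ} {C : ℝ} (hC : 0 ≤ C)
    (hρ : ∀ n : ℕ, 1 ≤ n → ‖polyRootWeylSum f n h‖ ≤ C * (Nat.divisors n).card)
    {d : ℕ} (hd : 1 ≤ d) (t : ℝ) {T : ℕ} (hT : ⌊t⌋₊ ≤ T) :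
    ‖partialSum f h d t‖ ≤ C * (Nat.divisors d).card * (T * (1 + Real.log T)) := by
  unfold partialSum
  calc ‖∑ m ∈ Icc 1 ⌊t⌋₊, polyRootWeylSum f (d * m) h‖
      ≤ ∑ m ∈ Icc 1 ⌊t⌋₊, ‖polyRootWeylSum f (d * m) h‖ := norm_sum_le _ _
    _ ≤ ∑ m ∈ Icc 1 ⌊t⌋₊, C * (Nat.divisors d).card * (Nat.divisors m).card := by
        refine Finset.sum_le_sum fun m hm => ?_
        have hm1 : 1 ≤ m := (Finset.mem_Icc.1 hm).1
        refine (hρ (d * m) (Nat.one_le_iff_ne_zero.2 (Nat.mul_ne_zero (by omega) (by omega)))).trans ?_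
        rw [mul_assoc]
        refine mul_le_mul_of_nonneg_left ?_ hC
        exact_mod_cast Vaughan.card_divisors_mul_le d m
    _ = C * (Nat.divisors d).card * ∑ m ∈ Icc 1 ⌊t⌋₊, ((Nat.divisors m).card : ℝ) := by
        rw [Finset.mul_sum]
    _ ≤ C * (Nat.divisors d).card * ∑ m ∈ Icc 1 T, ((Nat.divisors m).card : ℝ) := by
        refine mul_le_mul_of_nonneg_left (Finset.sum_le_sum_of_subset_of_nonneg
          (Finset.Icc_subset_Icc_right hT) fun _ _ _ => by positivity) (by positivity)
    _ ≤ C * (Nat.divisors d).card * (T * (1 + Real.log T)) := by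
        refine mul_le_mul_of_nonneg_left ?_ (by positivity)
        have := Vaughan.sum_card_divisors_le T
        rwa [Vaughan.Ioc_zero_eq_Icc_one] at this

/-- `(d/M)^{1/20} M^{1+ε} = d^{1/20} M^{19/20+ε}` for `d, M > 0`. [folklore] -/
theorem div_rpow_mul_rpow {d M : ℝ} (hd : 0 < d) (hM : 0 < M) (ε : ℝ) :
    (d / M) ^ (1 / 20 : ℝ) * M ^ (1 + ε) = d ^ (1 / 20 : ℝ) * M ^ (19 / 20 + ε) := by
  rw [Real.div_rpow hd.le hM.le, div_mul_eq_mul_div, mul_div_assoc, ← Real.rpow_sub hM,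
    show (1 + ε - 1 / 20 : ℝ) = 19 / 20 + ε by ring]

/-- **Proposition 1, packaged**: for `f = aX² + 2bX + c` (`ac > b²`), `h ≥ 1`, `ε > 0` there is
`K₁ ≥ 0` with `|L_d(M)| ≤ K₁ d^{1/20} M^{19/20+ε}` whenever `1 ≤ d ≤ M` (from (9) with
`(h, d) ≤ h`, `d ≤ M`, `h ≤ h d M`). [folklore] -/
theorem exists_norm_linearForm_le (H1 : dukeFriedlanderIwaniec1995_proposition1) {a b c : ℤ}
    (hD : 0 < a * c - b ^ 2) {h : ℕ} (hh : 1 ≤ h) {ε : ℝ} (hε : 0 < ε) :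
    ∃ K₁ : ℝ, 0 ≤ K₁ ∧ ∀ d : ℕ, 1 ≤ d → ∀ M : ℝ, (d : ℝ) ≤ M →
      ‖linearForm (quad a b c) h d M‖ ≤ K₁ * (d : ℝ) ^ (1 / 20 : ℝ) * M ^ (19 / 20 + ε) := by
  obtain ⟨K, hK⟩ := H1 a b c hD ε hε 1 h one_pos (by exact_mod_cast hh)
  refine ⟨max K 0 * (h : ℝ) ^ (1 / 20 : ℝ), by positivity, fun d hd M hdM => ?_⟩
  have hd0 : (0 : ℝ) < d := by exact_mod_cast hd
  have hM1 : (1 : ℝ) ≤ M := le_trans (by exact_mod_cast hd) hdM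
  have hM0 : 0 < M := by linarith
  have h1d : (1 : ℝ) ≤ d := by exact_mod_cast hd
  have hbound := hK h hh d hd M hM1 (by linarith) (by
    have : (1 : ℝ) ≤ d * M := one_le_mul_of_one_le_of_one_le h1d hM1
    calc (h : ℝ) = h * 1 := by ring
      _ ≤ h * (d * M) := by gcongr
      _ = h * d * M := by ring)
  refine hbound.trans ?_
  have hgcd : ((Nat.gcd h d : ℕ) : ℝ) ^ (1 / 20 : ℝ) ≤ (h : ℝ) ^ (1 / 20 : ℝ) :=
    Real.rpow_le_rpow (Nat.cast_nonneg _) (by exact_mod_cast Nat.gcd_le_left d hh) (by norm_num)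
  rw [mul_assoc (K * _), div_rpow_mul_rpow hd0 hM0 ε]
  have hnn : 0 ≤ (d : ℝ) ^ (1 / 20 : ℝ) * M ^ (19 / 20 + ε) := by positivity
  calc K * ((Nat.gcd h d : ℕ) : ℝ) ^ (1 / 20 : ℝ) * ((d : ℝ) ^ (1 / 20 : ℝ) * M ^ (19 / 20 + ε))
      ≤ max K 0 * (h : ℝ) ^ (1 / 20 : ℝ) * ((d : ℝ) ^ (1 / 20 : ℝ) * M ^ (19 / 20 + ε)) := by
        apply mul_le_mul_of_nonneg_right _ hnn
        calc K * ((Nat.gcd h d : ℕ) : ℝ) ^ (1 / 20 : ℝ) ≤ max K 0 * ((Nat.gcd h d : ℕ) : ℝ) ^ (1 / 20 : ℝ) :=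
              mul_le_mul_of_nonneg_right (le_max_left _ _) (by positivity)
          _ ≤ max K 0 * (h : ℝ) ^ (1 / 20 : ℝ) := mul_le_mul_of_nonneg_left hgcd (le_max_right _ _)
    _ = max K 0 * (h : ℝ) ^ (1 / 20 : ℝ) * (d : ℝ) ^ (1 / 20 : ℝ) * M ^ (19 / 20 + ε) := by ring

/-- **The inner sum over `m ≤ x/d`**: trivial bound below `2d`, Proposition 1 on the
`J ≤ log₂ x` dyadic blocks above. [folklore] -/
theorem norm_partialSum_floor_div_le {f : ℤ[X]} {h : ℤ} {C K₁ ε : ℝ} (hC : 0 ≤ C) (hK₁ : 0 ≤ K₁)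
    (hε : 0 ≤ 19 / 20 + ε)
    (hρ : ∀ n : ℕ, 1 ≤ n → ‖polyRootWeylSum f n h‖ ≤ C * (Nat.divisors n).card)
    (hL : ∀ d : ℕ, 1 ≤ d → ∀ M : ℝ, (d : ℝ) ≤ M →
      ‖linearForm f h d M‖ ≤ K₁ * (d : ℝ) ^ (1 / 20 : ℝ) * M ^ (19 / 20 + ε))
    {d : ℕ} (hd : 1 ≤ d) {x : ℝ} (hx : 1 ≤ x) :
    ‖partialSum f h d ((⌊x⌋₊ / d : ℕ) : ℝ)‖ ≤
      C * (Nat.divisors d).card * ((2 * d : ℕ) * (1 + Real.log (2 * d : ℕ))) +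
        (Nat.log 2 ⌊x⌋₊ : ℝ) * (K₁ * (d : ℝ) ^ (1 / 20 : ℝ) * (x / d) ^ (19 / 20 + ε)) := by
  set n : ℕ := ⌊x⌋₊ / d with hn
  set q : ℕ := n / d with hq
  set J : ℕ := Nat.log 2 q with hJ
  have hd0 : (0 : ℝ) < d := by exact_mod_cast hd
  have hX0 : (0 : ℝ) ≤ n := Nat.cast_nonneg _
  rw [partialSum_eq_dyadic f h d hX0 J]
  -- the leftover `m ≤ n/2^J < 2d`
  have hnlt : (n : ℝ) < d * (2 * 2 ^ J) := by
    have h1 : n < d * (q + 1) := by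
      have := Nat.div_add_mod n d
      have hmod := Nat.mod_lt n (show 0 < d by omega)
      rw [hq]; nlinarith
    have h2 : q + 1 ≤ 2 * 2 ^ J := by
      have := Nat.lt_pow_succ_log_self (b := 2) one_lt_two q
      rw [← hJ, pow_succ] at this; omega
    calc (n : ℝ) < (d * (q + 1) : ℕ) := by exact_mod_cast h1
      _ ≤ (d * (2 * 2 ^ J) : ℕ) := by exact_mod_cast Nat.mul_le_mul_left d h2
      _ = d * (2 * 2 ^ J) := by push_cast; ring
  have hleft_floor : ⌊(n : ℝ) / 2 ^ J⌋₊ ≤ 2 * d := by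
    refine Nat.floor_le_of_le ?_
    rw [div_le_iff₀ (by positivity)]
    push_cast
    linarith
  have hleft := norm_partialSum_le hC hρ hd ((n : ℝ) / 2 ^ J) hleft_floor
  -- the dyadic blocks
  have hJle : J ≤ Nat.log 2 ⌊x⌋₊ := by
    refine Nat.log_mono_right ((Nat.div_le_self _ _).trans (Nat.div_le_self _ _))
  have hnle : (n : ℝ) ≤ x / d := by
    calc (n : ℝ) ≤ (⌊x⌋₊ : ℝ) / d := Nat.cast_div_le
      _ ≤ x / d := by gcongr; exact Nat.floor_le (by linarith)
  have hblock : ∀ j ∈ Finset.range J,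
      ‖linearForm f h d ((n : ℝ) / 2 ^ (j + 1))‖ ≤
        K₁ * (d : ℝ) ^ (1 / 20 : ℝ) * (x / d) ^ (19 / 20 + ε) := by
    intro j hj
    rw [Finset.mem_range] at hj
    have hJ1 : 1 ≤ J := by omega
    have hq0 : q ≠ 0 := by
      intro h0
      rw [hJ, h0, Nat.log_zero_right] at hJ1
      exact absurd hJ1 (by norm_num)
    have hpow : 2 ^ (j + 1) ≤ q := by
      have h1 : 2 ^ (j + 1) ≤ 2 ^ J := Nat.pow_le_pow_right (by norm_num) hj
      have h2 : 2 ^ J ≤ q := by rw [hJ]; exact Nat.pow_log_le_self 2 hq0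
      exact h1.trans h2
    have hdM : (d : ℝ) ≤ (n : ℝ) / 2 ^ (j + 1) := by
      rw [le_div_iff₀ (by positivity)]
      have : d * 2 ^ (j + 1) ≤ n := by
        calc d * 2 ^ (j + 1) ≤ d * q := Nat.mul_le_mul_left d hpow
          _ = n / d * d := by rw [hq, mul_comm]
          _ ≤ n := Nat.div_mul_le_self n d
      exact_mod_cast this
    refine (hL d hd _ hdM).trans ?_
    refine mul_le_mul_of_nonneg_left ?_ (by positivity)
    refine Real.rpow_le_rpow (by positivity) ?_ hε
    calc (n : ℝ) / 2 ^ (j + 1) ≤ n := by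
          rw [div_le_iff₀ (by positivity)]
          have : (1 : ℝ) ≤ 2 ^ (j + 1) := one_le_pow₀ (by norm_num)
          nlinarith
      _ ≤ x / d := hnle
  calc ‖partialSum f h d ((n : ℝ) / 2 ^ J) + ∑ j ∈ Finset.range J, linearForm f h d ((n : ℝ) / 2 ^ (j + 1))‖
      ≤ ‖partialSum f h d ((n : ℝ) / 2 ^ J)‖ + ∑ j ∈ Finset.range J, ‖linearForm f h d ((n : ℝ) / 2 ^ (j + 1))‖ :=
        (norm_add_le _ _).trans (by gcongr; exact norm_sum_le _ _)
    _ ≤ C * (Nat.divisors d).card * ((2 * d : ℕ) * (1 + Real.log (2 * d : ℕ))) +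
        ∑ j ∈ Finset.range J, K₁ * (d : ℝ) ^ (1 / 20 : ℝ) * (x / d) ^ (19 / 20 + ε) :=
        add_le_add hleft (Finset.sum_le_sum hblock)
    _ ≤ C * (Nat.divisors d).card * ((2 * d : ℕ) * (1 + Real.log (2 * d : ℕ))) +
        (Nat.log 2 ⌊x⌋₊ : ℝ) * (K₁ * (d : ℝ) ^ (1 / 20 : ℝ) * (x / d) ^ (19 / 20 + ε)) := by
        gcongr
        rw [Finset.sum_const, Finset.card_range, nsmul_eq_mul]
        exact mul_le_mul_of_nonneg_right (by exact_mod_cast hJle) (by positivity)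

/-! ### Summing over `d < D = x^{1/2−ε}` -/

/-- `Nat.log 2 ⌊x⌋₊ ≤ 2 log x` for `x ≥ 1`. [folklore] -/
theorem natLog_two_floor_le {x : ℝ} (hx : 1 ≤ x) : (Nat.log 2 ⌊x⌋₊ : ℝ) ≤ 2 * Real.log x := by
  set L := Nat.log 2 ⌊x⌋₊ with hL
  have hn0 : ⌊x⌋₊ ≠ 0 := Nat.pos_iff_ne_zero.1 (Nat.floor_pos.2 hx)
  have hpow : (2 : ℝ) ^ L ≤ x := by
    have h1 : 2 ^ L ≤ ⌊x⌋₊ := by rw [hL]; exact Nat.pow_log_le_self 2 hn0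
    calc (2 : ℝ) ^ L = ((2 ^ L : ℕ) : ℝ) := by push_cast; ring
      _ ≤ (⌊x⌋₊ : ℝ) := by exact_mod_cast h1
      _ ≤ x := Nat.floor_le (by linarith)
  have hlog : (L : ℝ) * Real.log 2 ≤ Real.log x := by
    rw [← Real.log_pow]
    exact Real.log_le_log (by positivity) hpow
  have hlog2 : (1 / 2 : ℝ) < Real.log 2 := by
    have := Real.log_two_gt_d9; linarith
  have hlogx : 0 ≤ Real.log x := Real.log_nonneg hx
  nlinarith

/-- `T (1 + log T) ≤ y (1 + log y)` for naturals `T ≤ y`, `y ≥ 1`. [folklore] -/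
theorem natCast_mul_one_add_log_le {T : ℕ} {y : ℝ} (hTy : (T : ℝ) ≤ y) (hy : 1 ≤ y) :
    (T : ℝ) * (1 + Real.log T) ≤ y * (1 + Real.log y) := by
  rcases Nat.eq_zero_or_pos T with rfl | hT
  · simp only [Nat.cast_zero, zero_mul]
    have : 0 ≤ Real.log y := Real.log_nonneg hy
    positivity
  · have hT1 : (1 : ℝ) ≤ T := by exact_mod_cast hT
    have hlogT : Real.log T ≤ Real.log y := Real.log_le_log (by linarith) hTy
    have : 0 ≤ Real.log (T : ℝ) := Real.log_nonneg hT1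
    nlinarith

/-- The summand of the dyadic part: `d^{1/20} (x/d)^{19/20+ε'} ≤ x^{19/20+ε'} D^{1/10} / d` for
`1 ≤ d ≤ D`, `ε' ≥ 0`. [folklore] -/
theorem rpow_mul_div_rpow_le {d D x ε' : ℝ} (hd : 1 ≤ d) (hdD : d ≤ D) (hx : 0 < x) (hε' : 0 ≤ ε') :
    d ^ (1 / 20 : ℝ) * (x / d) ^ (19 / 20 + ε') ≤ x ^ (19 / 20 + ε') * D ^ (1 / 10 : ℝ) / d := by
  have hd0 : 0 < d := by linarith
  rw [Real.div_rpow hx.le hd0.le, mul_div_assoc', mul_comm (d ^ (1 / 20 : ℝ)), mul_div_assoc,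
    mul_div_assoc]
  refine mul_le_mul_of_nonneg_left ?_ (by positivity)
  rw [div_eq_mul_inv, ← Real.rpow_neg hd0.le, ← Real.rpow_add hd0,
    show (1 / 20 + -(19 / 20 + ε') : ℝ) = -(9 / 10) - ε' by ring]
  calc d ^ (-(9 / 10 : ℝ) - ε') ≤ d ^ (-(9 / 10 : ℝ)) :=
        Real.rpow_le_rpow_of_exponent_le hd (by linarith)
    _ = d ^ (1 / 10 : ℝ) * d ^ (-1 : ℝ) := by
        rw [← Real.rpow_add hd0]; norm_num
    _ ≤ D ^ (1 / 10 : ℝ) * d ^ (-1 : ℝ) := by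
        gcongr
    _ = D ^ (1 / 10 : ℝ) / d := by
        rw [Real.rpow_neg_one]; ring

/-- **(34) for `ρ_h` from Proposition 1** (the first deduction of §7): summing the inner bounds
over `d < D = x^{1/2−ε}` gives `|R(D)| ≤ (2C_f + 2K₁) x^{1−ε/20} (1 + log x)²`, which is
`≤ A x (log x)^{−2}` for large `x`. [cite: DukeFriedlanderIwaniec1995, §7 p. 438] -/
theorem hyp34_of_proposition1 (H1 : dukeFriedlanderIwaniec1995_proposition1) {a b c : ℤ}
    (hD : 0 < a * c - b ^ 2) {h : ℕ} (hh : 1 ≤ h) {ε : ℝ} (hε : 0 < ε) (hε12 : ε ≤ 1 / 12) :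
    Hyp34 (quad a b c) h ε := by
  obtain ⟨Cρ, hCρ, hρ⟩ := exists_norm_polyRootWeylSum_quad_le hD
  have hCρ0 : 0 ≤ Cρ := by linarith
  set ε' : ℝ := ε / 20 with hε'
  have hε'0 : 0 < ε' := by positivity
  obtain ⟨K₁, hK₁, hL⟩ := exists_norm_linearForm_le H1 hD hh hε'0
  -- where the power saving beats the logarithms: `(log x)^4 ≤ x^{ε'}/4` for `x ≥ x₂`
  have hlo := (isLittleO_log_rpow_rpow_atTop (4 : ℝ) hε'0).bound (by norm_num : (0 : ℝ) < 1 / 4)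
  obtain ⟨x₂, hx₂⟩ := Filter.eventually_atTop.1 hlo
  set A : ℝ := 2 * Cρ + 2 * K₁ with hA
  refine ⟨max x₂ (Real.exp 2), A, fun x hx lam hlam => ?_⟩
  have hx₂x : x₂ ≤ x := (le_max_left _ _).trans hx
  have hxe : Real.exp 2 ≤ x := (le_max_right _ _).trans hx
  have hx4 : (4 : ℝ) ≤ x := by
    have h1 : (2 : ℝ) ≤ Real.exp 1 := by
      have := Real.add_one_le_exp (1 : ℝ); linarith
    have h2 : Real.exp 2 = Real.exp 1 * Real.exp 1 := by rw [← Real.exp_add]; norm_num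
    nlinarith
  have hx1 : (1 : ℝ) ≤ x := by linarith
  have hx0 : (0 : ℝ) < x := by linarith
  have hlogx : 2 ≤ Real.log x := by
    rw [← Real.log_exp 2]; exact Real.log_le_log (Real.exp_pos 2) hxe
  set D : ℝ := x ^ (1 / 2 - ε) with hDdef
  have hD1 : 1 ≤ D := Real.one_le_rpow hx1 (by linarith)
  have hD0 : 0 < D := by linarith
  have hDx : 2 * D ≤ x := by
    have hhalf : D ≤ x ^ (1 / 2 : ℝ) := Real.rpow_le_rpow_of_exponent_le hx1 (by linarith)
    have hsq : x ^ (1 / 2 : ℝ) * x ^ (1 / 2 : ℝ) = x := by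
      rw [← Real.rpow_add hx0]; norm_num
    have h2 : (2 : ℝ) ≤ x ^ (1 / 2 : ℝ) := by
      have : (4 : ℝ) ^ (1 / 2 : ℝ) ≤ x ^ (1 / 2 : ℝ) :=
        Real.rpow_le_rpow (by norm_num) hx4 (by norm_num)
      have h4 : (4 : ℝ) ^ (1 / 2 : ℝ) = 2 := by
        rw [show (4 : ℝ) = 2 ^ (2 : ℝ) by norm_num, ← Real.rpow_mul (by norm_num)]; norm_num
      linarith
    nlinarith [Real.rpow_nonneg hx0.le (1 / 2 : ℝ)]
  have hDlex : D ≤ x := by linarith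
  have hlogD : Real.log D ≤ Real.log x := Real.log_le_log hD0 hDlex
  have hlog2D : Real.log (2 * D) ≤ Real.log x := Real.log_le_log (by linarith) hDx
  have hlx0 : 0 < Real.log x := by linarith
  have hD2 : D * D = x ^ (1 - 2 * ε) := by
    rw [hDdef, ← Real.rpow_add hx0]; ring_nf
  have hxD : x ^ (19 / 20 + ε') * D ^ (1 / 10 : ℝ) = x ^ (1 - ε / 20) := by
    rw [hDdef, ← Real.rpow_mul hx0.le, ← Real.rpow_add hx0, hε']; ring_nf
  have hD2le : x ^ (1 - 2 * ε) ≤ x ^ (1 - ε / 20) :=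
    Real.rpow_le_rpow_of_exponent_le hx1 (by linarith)
  -- Step 1: `|R(D)| ≤ ∑_{d < D} |S_d(⌊x⌋/d)|`
  set F : Finset ℕ := (Icc 1 ⌊x⌋₊).filter (fun d : ℕ => (d : ℝ) < D) with hF
  have hFmem : ∀ d ∈ F, 1 ≤ d ∧ d ≤ ⌊x⌋₊ ∧ (d : ℝ) < D := fun d hd => by
    rw [hF, Finset.mem_filter, Finset.mem_Icc] at hd; exact ⟨hd.1.1, hd.1.2, hd.2⟩
  have step1 : ‖sieveR₁ (rhoSeq (quad a b c) h) lam x D‖ ≤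
      ∑ d ∈ F, ‖partialSum (quad a b c) h d ((⌊x⌋₊ / d : ℕ) : ℝ)‖ := by
    unfold sieveR₁
    refine (norm_sum_le _ _).trans (Finset.sum_le_sum fun d hd => ?_)
    rw [norm_mul]
    have hps : ∑ m ∈ Icc 1 (⌊x⌋₊ / d), rhoSeq (quad a b c) (h : ℤ) (d * m) =
        partialSum (quad a b c) h d ((⌊x⌋₊ / d : ℕ) : ℝ) := by
      unfold partialSum; rw [Nat.floor_natCast]; rfl
    rw [hps]
    calc ‖lam d‖ * ‖partialSum (quad a b c) (↑h) d ((⌊x⌋₊ / d : ℕ) : ℝ)‖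
        ≤ 1 * ‖partialSum (quad a b c) (↑h) d ((⌊x⌋₊ / d : ℕ) : ℝ)‖ :=
          mul_le_mul_of_nonneg_right (hlam d) (norm_nonneg _)
      _ = _ := one_mul _
  -- Step 2: the inner bound, per `d`
  have hε'' : 0 ≤ 19 / 20 + ε' := by positivity
  have step2 : ∀ d ∈ F, ‖partialSum (quad a b c) h d ((⌊x⌋₊ / d : ℕ) : ℝ)‖ ≤
      Cρ * (2 * D * (1 + Real.log x)) * (Nat.divisors d).card +
        2 * Real.log x * (K₁ * (x ^ (1 - ε / 20) / d)) := by
    intro d hdF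
    obtain ⟨hd, -, hdD⟩ := hFmem d hdF
    have hd1 : (1 : ℝ) ≤ d := by exact_mod_cast hd
    refine (norm_partialSum_floor_div_le hCρ0 hK₁ hε'' (hρ h) hL hd hx1).trans ?_
    gcongr ?_ + ?_
    · -- `Cρ τ(d) (2d)(1 + log 2d) ≤ Cρ (2D(1 + log x)) τ(d)`
      rw [mul_assoc, mul_assoc, mul_comm ((Nat.divisors d).card : ℝ)]
      refine mul_le_mul_of_nonneg_left (mul_le_mul_of_nonneg_right ?_ (Nat.cast_nonneg _)) hCρ0
      have h2d : ((2 * d : ℕ) : ℝ) ≤ 2 * D := by push_cast; linarith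
      have h2d1 : (1 : ℝ) ≤ ((2 * d : ℕ) : ℝ) := by push_cast; linarith
      have hlog2d : Real.log ((2 * d : ℕ) : ℝ) ≤ Real.log x :=
        (Real.log_le_log (by linarith) h2d).trans hlog2D
      have : 0 ≤ Real.log ((2 * d : ℕ) : ℝ) := Real.log_nonneg h2d1
      nlinarith
    · calc (Nat.log 2 ⌊x⌋₊ : ℝ) * (K₁ * (d : ℝ) ^ (1 / 20 : ℝ) * (x / d) ^ (19 / 20 + ε'))
          = (Nat.log 2 ⌊x⌋₊ : ℝ) * (K₁ * ((d : ℝ) ^ (1 / 20 : ℝ) * (x / d) ^ (19 / 20 + ε'))) := by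
            ring
        _ ≤ 2 * Real.log x * (K₁ * (x ^ (19 / 20 + ε') * D ^ (1 / 10 : ℝ) / d)) := by
            gcongr
            · exact natLog_two_floor_le hx1
            · exact rpow_mul_div_rpow_le hd1 hdD.le hx0 hε'0.le
        _ = 2 * Real.log x * (K₁ * (x ^ (1 - ε / 20) / d)) := by rw [hxD]
  -- Step 3: summing over `d < D`
  have hFsub1 : F ⊆ Icc 1 ⌊D⌋₊ := by
    intro d hd
    obtain ⟨h1, -, h3⟩ := hFmem d hd
    exact Finset.mem_Icc.2 ⟨h1, Nat.le_floor h3.le⟩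
  have hFsub2 : F ⊆ Icc 1 ⌊x⌋₊ := Finset.filter_subset _ _
  have hτsum : ∑ d ∈ F, ((Nat.divisors d).card : ℝ) ≤ D * (1 + Real.log x) := by
    calc ∑ d ∈ F, ((Nat.divisors d).card : ℝ) ≤ ∑ d ∈ Icc 1 ⌊D⌋₊, ((Nat.divisors d).card : ℝ) :=
          Finset.sum_le_sum_of_subset_of_nonneg hFsub1 fun _ _ _ => by positivity
      _ ≤ ⌊D⌋₊ * (1 + Real.log ⌊D⌋₊) := by
          have := Vaughan.sum_card_divisors_le ⌊D⌋₊
          rwa [Vaughan.Ioc_zero_eq_Icc_one] at this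
      _ ≤ D * (1 + Real.log D) := natCast_mul_one_add_log_le (Nat.floor_le hD0.le) hD1
      _ ≤ D * (1 + Real.log x) := by gcongr
  have hinvsum : ∑ d ∈ F, (x ^ (1 - ε / 20) / d) ≤ x ^ (1 - ε / 20) * (1 + Real.log x) := by
    calc ∑ d ∈ F, (x ^ (1 - ε / 20) / d) = x ^ (1 - ε / 20) * ∑ d ∈ F, ((d : ℝ))⁻¹ := by
          rw [Finset.mul_sum]; exact Finset.sum_congr rfl fun d _ => by rw [div_eq_mul_inv]
      _ ≤ x ^ (1 - ε / 20) * ∑ d ∈ Icc 1 ⌊x⌋₊, ((d : ℝ))⁻¹ :=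
          mul_le_mul_of_nonneg_left
            (Finset.sum_le_sum_of_subset_of_nonneg hFsub2 fun _ _ _ => by positivity)
            (by positivity)
      _ ≤ x ^ (1 - ε / 20) * (1 + Real.log ⌊x⌋₊) := by
          have h1 := Vaughan.sum_Ioc_inv_le ⌊x⌋₊
          rw [Vaughan.Ioc_zero_eq_Icc_one] at h1
          exact mul_le_mul_of_nonneg_left h1 (by positivity)
      _ ≤ x ^ (1 - ε / 20) * (1 + Real.log x) := by
          have h1 : Real.log (⌊x⌋₊ : ℝ) ≤ Real.log x :=
            Real.log_le_log (by exact_mod_cast Nat.floor_pos.2 hx1) (Nat.floor_le hx0.le)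
          exact mul_le_mul_of_nonneg_left (by linarith) (by positivity)
  have step3 : ‖sieveR₁ (rhoSeq (quad a b c) h) lam x D‖ ≤
      A * x ^ (1 - ε / 20) * (1 + Real.log x) ^ 2 := by
    refine step1.trans ((Finset.sum_le_sum step2).trans ?_)
    rw [Finset.sum_add_distrib, ← Finset.mul_sum, ← Finset.mul_sum, ← Finset.mul_sum]
    have hl1 : 0 ≤ 1 + Real.log x := by linarith
    calc Cρ * (2 * D * (1 + Real.log x)) * ∑ d ∈ F, ((Nat.divisors d).card : ℝ) +
          2 * Real.log x * (K₁ * ∑ d ∈ F, x ^ (1 - ε / 20) / d)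
        ≤ Cρ * (2 * D * (1 + Real.log x)) * (D * (1 + Real.log x)) +
          2 * Real.log x * (K₁ * (x ^ (1 - ε / 20) * (1 + Real.log x))) := by
          gcongr
      _ = 2 * Cρ * (D * D) * (1 + Real.log x) ^ 2 +
          2 * K₁ * x ^ (1 - ε / 20) * (Real.log x * (1 + Real.log x)) := by ring
      _ ≤ 2 * Cρ * x ^ (1 - ε / 20) * (1 + Real.log x) ^ 2 +
          2 * K₁ * x ^ (1 - ε / 20) * ((1 + Real.log x) * (1 + Real.log x)) := by
          rw [hD2]
          gcongr
          linarith
      _ = A * x ^ (1 - ε / 20) * (1 + Real.log x) ^ 2 := by rw [hA]; ring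
  -- Step 4: `x^{1−ε/20} (1 + log x)² ≤ x / (log x)²`
  have hsave : x ^ (1 - ε / 20) * (1 + Real.log x) ^ 2 ≤ x / Real.log x ^ 2 := by
    have h4 : Real.log x ^ 4 ≤ x ^ ε' / 4 := by
      have := hx₂ x hx₂x
      rw [show (4 : ℝ) = ((4 : ℕ) : ℝ) by norm_num, Real.rpow_natCast,
        Real.norm_of_nonneg (by positivity), Real.norm_of_nonneg (by positivity)] at this
      linarith
    have hsplit : x = x ^ (1 - ε / 20) * x ^ ε' := by
      rw [← Real.rpow_add hx0, hε']; ring_nf; exact (Real.rpow_one x).symm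
    rw [le_div_iff₀ (by positivity)]
    have h1L : (1 + Real.log x) ^ 2 ≤ 4 * Real.log x ^ 2 := by nlinarith
    calc x ^ (1 - ε / 20) * (1 + Real.log x) ^ 2 * Real.log x ^ 2
        ≤ x ^ (1 - ε / 20) * (4 * Real.log x ^ 2) * Real.log x ^ 2 := by gcongr
      _ = x ^ (1 - ε / 20) * (4 * Real.log x ^ 4) := by ring
      _ ≤ x ^ (1 - ε / 20) * x ^ ε' := by
          refine mul_le_mul_of_nonneg_left (by linarith) (by positivity)
      _ = x := hsplit.symm
  have hA0 : 0 ≤ A := by rw [hA]; positivity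
  calc ‖sieveR₁ (rhoSeq (quad a b c) h) lam x (x ^ (1 / 2 - ε))‖
      = ‖sieveR₁ (rhoSeq (quad a b c) h) lam x D‖ := by rw [hDdef]
    _ ≤ A * (x ^ (1 - ε / 20) * (1 + Real.log x) ^ 2) := by rw [← mul_assoc]; exact step3
    _ ≤ A * (x / Real.log x ^ 2) := mul_le_mul_of_nonneg_left hsave hA0
    _ = A * x / Real.log x ^ 2 := by ring

end DFI1995

end Literature.NumberTheory.Sieve
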